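import Literature.MathematicalPhysics.QuantumFieldTheory.Balaban1983to89.B9Letters313AtOneL2

/-!
# `Balaban1983to89.B9Letters313AtOneL2DD` — [B9] Thm 3.13's BLOCK-L² reduction letters AT THE TRIVIAL BACKGROUND, fourth batch: the PAIR letters
# `Letters313L2PZ.ddGQs q` (`‖1_{Δ(y)}∇_{U,ν}∇_{U,μ}G₀(1)Q*(1)ω‖ ≤ B₄·(Lʲη)⁻¹·(√wZ y′·L^{j′}η)·e^{−δd}‖ω‖`) HOLD AT `U = 1`, uniformly on the census

T. Bałaban, *Propagators for lattice gauge theories in a background field*, Commun. Math. Phys. **99** (1985) 389–434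
[`Balaban1985BackgroundPropagators`, "B9"]; [4] = T. Bałaban, *Propagators and renormalization transformations for lattice gauge
theories. II*, Commun. Math. Phys. **96** (1984) 223–250 [`Balaban1984PropagatorsII`].

statement-level skeleton of published theorems with citation tags; proofs where landed; nothing here is a claim about the Yang–Mills mass gap

THE PRINTED LOCI (verbatim).  [B9] p. 426 (Thm 3.13), (3.153); (3.46) p. 398; (3.133) p. 422; (3.42) p. 397; Cor. 3.5 p. 407; [4] Prop. 2.6 (2.140)
p. 247 (member `‖ζ∇∇GJ‖ ≦ C e^{−δd}‖J‖`), Lemma 2.1 (2.60)–(2.61) p. 234.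

THE POINT.  dag-n06-d's certificate (ed. 22) displays `hLL2 : Letters313L2PZ (𝔬12 x) (𝔡A x).Dd (𝔡A x).Dsd 1 (H x) B13₄ δ12₃ (√wZ) … U ∧ …` whose
field `ddGQs q` (`q = (ν, μ)`) is the block-L² bound of the second covariant derivatives of `G₀Q*`, with `Dd` PINNED by `h𝔡Ad` to the constant family
of one covariant derivative.  THIS FILE inhabits `ddGQs q` at `U ↦ 1` for every pair `q`: the pinned composite `(∇_{U,ν} ∘ ∇_{U,μ}) ∘ G₀(1) ∘ Q*(1)`
is the mixed model of `∇_{1,ν}∇_{1,μ} ∘ O(1) ∘ Q*(1)` (`coordOpK2_cdB_GcoK_comp_QscoKH_one`, by `coordOpK_comp` and dag-n06-h's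
`GcoK_comp_QscoKH_one`), acting on product-form inputs as `∇_ν∇_μ G Q*♭` (`cdB2_O_QsY_one_liftY`); the census member (2.140)₅ (`∇_ν∇_μG`, order
zero, `B9Prop26L2AtPinsOne.blockBd_Gop_kIdx` slot 5) is read through `B9Letters313AtOneL2.blockBd_comp_qsK_bI ∕ blockBd_coordOpKH_of_liftY`, and
the printed weight `(Lʲη)⁻¹·L^{j′}η` is produced from the engine's `1·L^{j′}η`-free kernel by ONE transfer (2.60) (`Lʲη ≦ L·e^{εd}·L^{j′}η`):
★★★ `blockBd_DdDd_G0_Qstar_one`, ★★★ `letters313_L2_ddGQs_one_kIdx` (every pair, uniformly on the census).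

HONEST SCOPE.  A READING file, inputs cited by name; nothing of [B9] at curved `U` asserted; `hLL2` NOT witnessed (A6 partial witnesses at `U = 1`);
the companion pair letter `ddGDv q` (`∇∇G₀∂`, weight `(Lʲη)⁻¹`) is NOT treated — the k-level census (2.140) as typed has no third-order member
`∇∇G∇*`.  COUNT-NEUTRAL; N06 NOT discharged; one finite lattice at a time; nothing continuum, nothing about the mass gap.
Cell `pub-ymgap` (HUMAN RULING D-0062 ∕ D-0149), node N06 [B9], rows 20–21 JSAT lane, width seat `pub-ymgap-dag-n06-w3` (g2), 2026-08-28.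
-/

noncomputable section

namespace Literature.MathematicalPhysics.QuantumFieldTheory.Balaban1983to89.B9Letters313AtOneL2DD

open B6MultiLevelTorusOperator (TDomains) open B6Geom246MultiLevelTorus (geomT) open B6GlobalChartV1 (PV blkV1 boxEquiv toBox)
open B6KLevelCensusIndexV1 (KIdx kGeo kGeoG) open B6Prop26Census2136KLevelV1 (Gop) open B6GradLegKLevelV1 (DV)
open B6Ineq2142KLevelV1 (lvl β) open B9Thm314GpFlatMultiLevelTorus (consts_260_261) open B6Lemma21Repaired (Ineq261With) open B9GeoNormsKLevelV1 (geo9K)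
open B9GeoLemma21KLevelV1 (one_le_Mh geo9K_len_pos geo9K_dist_comm geo9K_M_nonneg) open B9Thm39ReadingCoords (cR39 cR39_nonneg)
open B9CoReadingCoords B9CoReadingCoordsH open B9Thm34Ext (toB6) open B9SectDL2Decay (bsq bl2 BlockBd)
open B9LettersHAtOneG0 (GcoK_comp_QscoKH_one O_QsY_one_liftY) open B9Cor35ComparisonsGAAtLetters (cdB_one_liftY)
open B9Letters313AtOneQ (len_pow_le_of_transfer transfer_threshold)
open B9Prop26L2AtPinsOne (blockBd_Gop_kIdx) open B9Letters313AtOneL2 (blockBd_coordOpKH_of_liftY blockBd_comp_qsK_bI)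
open Node00 Node00.OpsYSectDCoords B9Thm312Whole
open scoped Matrix

variable {d ℓ : ℕ} {hd : 1 ≤ d + 1} {hL : Odd (ℓ + 1) ∧ 1 < ℓ + 1} {b₀ b₁ : ℝ}

section Pair

variable {𝔸 : Type} [NormedRing 𝔸] [NormedAlgebra ℂ 𝔸] [CompleteSpace 𝔸] [FiniteDimensional ℝ 𝔸]
variable {κ : Type} [Fintype κ]
variable (i : KIdx d ℓ hd hL b₀ b₁) (b : Module.Basis κ ℝ 𝔸) (B : B9.Backgrounds) (cfg : B.Cfg → CfgY 𝔸 i) (O : BondOpY 𝔸 i) (parB : BondParY 𝔸 i)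
variable {Y W : Type}

/-- ★ the pinned PAIR of single-direction derivatives after `G₀Q*`, at `U = 1`, is the mixed model of `∇_{1,ν}∇_{1,μ} ∘ O(1) ∘ Q*(1)`.
[cite: Balaban1985BackgroundPropagators, (3.133) p.422, (3.42) p.397, Cor. 3.5 p.407, dictionary] -/
theorem coordOpK2_cdB_GcoK_comp_QscoKH_one (hc : cR39 b ≠ 0) {U₁ : B.Cfg} (hU₁ : cfg U₁ = fun _ _ => 1) (ν μ : Fin (d + 1)) :
    (coordOpK b (fun _ : Fin (d + 1) => cdBₗ i (cfg U₁) ν) ∘ₗ coordOpK b (fun _ : Fin (d + 1) => cdBₗ i (cfg U₁) μ)) ∘ₗ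
        GcoK i b B cfg O U₁ ∘ₗ QscoKH i b B cfg parB U₁ =
      coordOpKH b (fun _ : Fin (d + 1) => (cdBₗ i (fun _ _ => 1) ν ∘ₗ cdBₗ i (fun _ _ => 1) μ) ∘ₗ
        ((O (fun _ _ => 1)).restrictScalars ℝ ∘ₗ (QsY i parB (fun _ _ => 1)).restrictScalars ℝ)) := by
  rw [GcoK_comp_QscoKH_one i b B cfg O parB hc hU₁, hU₁, coordOpK_comp, coordOpK_comp_coordOpKH]

omit [FiniteDimensional ℝ 𝔸] [Fintype κ] in
/-- the flat family `∇_ν∇_μ ∘ O(1) ∘ Q*(1)` acts on product-form inputs as the real operator `∇_ν∇_μ G Q*♭`.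
[cite: Balaban1985BackgroundPropagators, (3.14)–(3.15) p.393, (3.3) p.390, Cor. 3.5 p.407, dictionary] -/
theorem cdB2_O_QsY_one_liftY (hparB : ∀ s s', parB (fun _ _ => 1) s s' = 1)
    (hO : ∀ (J : FBondY i → ℝ) (E : 𝔸), O (fun _ _ => 1) (liftY J E) = liftY (Gop i J) E) (ν μ : Fin (d + 1)) (ω : IBondY i → ℝ) (E : 𝔸) :
    ((cdBₗ i (fun _ _ => 1) ν ∘ₗ cdBₗ i (fun _ _ => 1) μ) ∘ₗ
        ((O (fun _ _ => 1)).restrictScalars ℝ ∘ₗ (QsY i parB (fun _ _ => 1)).restrictScalars ℝ)) (liftY ω E) =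
      liftY (((DV ν i.cf ∘ₗ DV μ i.cf ∘ₗ Gop i) ∘ₗ Matrix.toLin' (qsK i)) ω) E := by
  rw [LinearMap.comp_apply, O_QsY_one_liftY i O parB hparB hO, LinearMap.comp_apply, cdBₗ_apply, cdBₗ_apply, cdB_one_liftY, cdB_one_liftY]
  rfl

/-- ★★★ **THE PAIR LETTER `ddGQs (ν, μ)` OF `Letters313L2PZ` AT `U = 1`** — `‖1_{Δ(y)}∇_{U₁,ν}∇_{U₁,μ}G₀(1)Q*(1)ω‖ ≤ B·L·(Lʲη)⁻¹·(√wZ y′·L^{j′}η)·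
e^{−(¾δ−ε)d}‖ω‖`, pins `hG0co12 ∕ hQsco12 ∕ h𝔡Ad`, `hblk12 ∕ hblkZ12`; (2.140)₅ (order zero) through the `Q*♭` source, then ONE transfer (2.60)
producing the printed weight `(Lʲη)⁻¹·L^{j′}η` from `Lʲη ≦ L·e^{εd(y,y′)}·L^{j′}η`.
[cite: Balaban1985BackgroundPropagators, Thm 3.13 p.426, (3.46) p.398, (3.133) p.422, Cor. 3.5 p.407; Balaban1984PropagatorsII, Prop. 2.6 (2.140) p.247, Lemma 2.1 (2.60)–(2.61) p.234] -/
theorem blockBd_DdDd_G0_Qstar_one (hG : GeoOK (geo9K i)) [Fintype (geo9K i).Site]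
    (hc : cR39 b ≠ 0) (hparB : ∀ s s', parB (fun _ _ => 1) s s' = 1)
    (hO : ∀ (J : FBondY i → ℝ) (E : 𝔸), O (fun _ _ => 1) (liftY J E) = liftY (Gop i J) E) {U₁ : B.Cfg} (hU₁ : cfg U₁ = fun _ _ => 1)
    {bI : FBondY i → IBondY i} (hlev : ∀ f : FBondY i, lvl i.hN i.D i.hk (bI f) = (blkV1 i.hN i.D f).1.1)
    (hβ1 : ∀ f : FBondY i, (geomT i.D).dist (β i.hN i.D i.hk (bI f)) (blkV1 i.hN i.D f) ≤ 1)
    (𝔬 : Ops (geo9K i) B (XBK κ i) Y (XHK κ i) W) (hblk : 𝔬.blk = blkBK i bI) (hblkZ : 𝔬.blkZ = blkHK i)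
    (hG0 : 𝔬.G0 U₁ = GcoK i b B cfg O U₁) (hQs : 𝔬.Qstar U₁ = QscoKH i b B cfg parB U₁)
    (Dd : B.Cfg → Fin (d + 1) → Module.End ℝ (XBK κ i → ℝ)) (hDd : Dd U₁ = fun μ => coordOpK b (fun _ : Fin (d + 1) => cdBₗ i (cfg U₁) μ))
    {C δ c : ℝ} (hC : 0 ≤ C) (hδ : 0 ≤ δ) (hc0 : 0 ≤ c)
    (hT : ∀ ν μ : Fin (d + 1), BlockBd (g := geomT i.D) (blkV1 i.hN i.D) (blkV1 i.hN i.D) (DV ν i.cf ∘ₗ DV μ i.cf ∘ₗ Gop i)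
      (fun y y' => C * |i.cf|⁻¹ ^ 0 * ((ℓ : ℝ) + 1) ^ (0 * y.1.1) * Real.exp (-(δ * (geomT i.D).dist y y'))))
    (h261 : Ineq261With c (geomT i.D) δ (1 / 4)) {ε : ℝ} (hε : 0 < ε)
    (hM : Real.log (geo9K i).L ≤ ε * (2 * ((ℓ : ℝ) + 1) ^ 2 - 1) * (geo9K i).M) (ν μ : Fin (d + 1)) {R₀ : ℝ} {H₀ : Prop} :
    BlockBd (g := toB6 (geo9K i) R₀ H₀) 𝔬.blkZ 𝔬.blk ((Dd U₁ ν ∘ₗ Dd U₁ μ) ∘ₗ 𝔬.G0 U₁ ∘ₗ 𝔬.Qstar U₁)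
      (fun y y' => C * c * Real.exp (3 / 4 * δ * ((ℓ : ℝ) + 4)) * Real.sqrt (Real.exp (1 / 4 * δ) * c) * (geo9K i).L *
        (((geo9K i).len y)⁻¹ * (Real.sqrt (((((ℓ + 1 : ℕ) : ℝ) ^ (d + 1)) ^ lvl i.hN i.D i.hk y')⁻¹) * (geo9K i).len y')) *
        Real.exp (-((3 / 4 * δ - ε) * (geo9K i).dist y y'))) := by
  rw [hblk, hblkZ, hG0, hQs, hDd]
  beta_reduce
  rw [coordOpK2_cdB_GcoK_comp_QscoKH_one i b B cfg O parB hc hU₁ ν μ]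
  have hK := blockBd_coordOpKH_of_liftY b (G := toB6 (geo9K i) R₀ H₀) (blk' := fun a : IBondY i => a) (blk := bI)
    (T := fun _ : Fin (d + 1) => (DV ν i.cf ∘ₗ DV μ i.cf ∘ₗ Gop i) ∘ₗ Matrix.toLin' (qsK i))
    (fun _ ω E => cdB2_O_QsY_one_liftY i O parB hparB hO ν μ ω E) ?_
    fun _ => blockBd_comp_qsK_bI i hlev hβ1 hC hδ 0 (hT ν μ) h261 R₀ H₀
  swap
  · intro a a'; have := (hG.lenpos a).le; positivity
  refine B9SectDL2Decay.BlockBd.mono hK fun y y' => ?_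
  have ht : (geo9K i).len y ^ 1 ≤ (geo9K i).L ^ 1 * Real.exp (ε * (geo9K i).dist y' y) * (geo9K i).len y' ^ 1 :=
    len_pow_le_of_transfer i hε 1 (by rwa [Nat.cast_one, one_mul]) y' y
  rw [pow_one, pow_one, pow_one, geo9K_dist_comm i y' y] at ht
  rw [show ((ℓ : ℝ) + 3) + 1 = (ℓ : ℝ) + 4 by ring]
  have hly : 0 < (geo9K i).len y := hG.lenpos y
  set A : ℝ := C * c * Real.exp (3 / 4 * δ * ((ℓ : ℝ) + 4)) * Real.sqrt (Real.exp (1 / 4 * δ) * c) with hA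
  set v : ℝ := Real.sqrt (((((ℓ + 1 : ℕ) : ℝ) ^ (d + 1)) ^ lvl i.hN i.D i.hk y')⁻¹) with hv
  have hexp : Real.exp (-(3 / 4 * δ * (geo9K i).dist y y')) * Real.exp (ε * (geo9K i).dist y y') =
      Real.exp (-((3 / 4 * δ - ε) * (geo9K i).dist y y')) := by rw [← Real.exp_add]; congr 1; ring
  -- `1 ≤ (len y)⁻¹ · L · e^{εd} · len y'`
  have h1 : (1 : ℝ) ≤ ((geo9K i).len y)⁻¹ * ((geo9K i).L * Real.exp (ε * (geo9K i).dist y y') * (geo9K i).len y') := by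
    rw [le_inv_mul_iff₀ hly, mul_one]; exact ht
  calc A * (geo9K i).len y ^ 0 * Real.exp (-(3 / 4 * δ * (geo9K i).dist y y')) * v
      = A * v * Real.exp (-(3 / 4 * δ * (geo9K i).dist y y')) * 1 := by rw [pow_zero]; ring
    _ ≤ A * v * Real.exp (-(3 / 4 * δ * (geo9K i).dist y y')) *
        (((geo9K i).len y)⁻¹ * ((geo9K i).L * Real.exp (ε * (geo9K i).dist y y') * (geo9K i).len y')) :=
        mul_le_mul_of_nonneg_left h1 (by positivity)
    _ = A * (geo9K i).L * (((geo9K i).len y)⁻¹ * (v * (geo9K i).len y')) *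
        (Real.exp (-(3 / 4 * δ * (geo9K i).dist y y')) * Real.exp (ε * (geo9K i).dist y y')) := by ring
    _ = _ := by rw [hexp]

end Pair

/-! ## §2 Uniformly on the k-level census: `ddGQs q` at `U = 1` for every pair `q`, with the certificate's constants -/

section Record

variable {𝔸 : Type} [NormedRing 𝔸] [NormedAlgebra ℂ 𝔸] [CompleteSpace 𝔸] [FiniteDimensional ℝ 𝔸]
variable {κ : Type} [Fintype κ] {Y W : Type}

/-- ★★★ **`Letters313L2PZ.ddGQs q` AT `U = 1`, EVERY PAIR `q = (ν, μ)`, UNIFORMLY ON THE k-LEVEL CENSUS.**  There are `M₁, B₄, δ₄ > 0` (from [4]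
Prop. 2.6 (2.140)₅ uniformly in `k` and Lemma 2.1's constants) such that for every index `i` with `M₁ ≤ M`, every letter record `𝔬` over
`geo9K i` pinned at a configuration reading `1` as in dag-n06-d's certificate (`hG0co12`, `hQsco12`, `hblk12`, `hblkZ12`) and every direction family
pinned by `h𝔡Ad`: `BlockBd blkZ blk ((Dd U₁ q.1 ∘ Dd U₁ q.2) ∘ G₀ ∘ Q*)(B₄·(|Δ(y)|⁻¹·(√wZ y′·|Δ(y′)|))·e^{−δ₄d})`, `δ₄ = δ₃∕2` (`ε = δ₃∕4`,
threshold `4 log L ∕ δ₃ ≤ M`).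
[cite: Balaban1985BackgroundPropagators, Thm 3.13 p.426, (3.46) p.398, (3.133) p.422, Cor. 3.5 p.407; Balaban1984PropagatorsII, Prop. 2.6 (2.140) p.247, Lemma 2.1 (2.60)–(2.61) p.234] -/
theorem letters313_L2_ddGQs_one_kIdx (hb₀ : 0 < b₀) (hb₁ : b₀ ≤ b₁) : ∃ M₁ B₄ δ₄ : ℝ, 0 < M₁ ∧ 0 < B₄ ∧ 0 < δ₄ ∧
    ∀ i : KIdx d ℓ hd hL b₀ b₁, M₁ ≤ (geo9K i).M → ∀ (hG : GeoOK (geo9K i)) [Fintype (geo9K i).Site]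
      (b : Module.Basis κ ℝ 𝔸), cR39 b ≠ 0 → ∀ (B : B9.Backgrounds) (cfg : B.Cfg → CfgY 𝔸 i) (O : BondOpY 𝔸 i) (parB : BondParY 𝔸 i),
      (∀ s s', parB (fun _ _ => 1) s s' = 1) → (∀ (J : FBondY i → ℝ) (E : 𝔸), O (fun _ _ => 1) (liftY J E) = liftY (Gop i J) E) →
      ∀ {U₁ : B.Cfg}, cfg U₁ = (fun _ _ => 1) → ∀ {bI : FBondY i → IBondY i},
      (∀ f : FBondY i, lvl i.hN i.D i.hk (bI f) = (blkV1 i.hN i.D f).1.1) →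
      (∀ f : FBondY i, (geomT i.D).dist (β i.hN i.D i.hk (bI f)) (blkV1 i.hN i.D f) ≤ 1) →
      ∀ (𝔬 : Ops (geo9K i) B (XBK κ i) Y (XHK κ i) W),
      𝔬.blk = blkBK i bI → 𝔬.blkZ = blkHK i → 𝔬.G0 U₁ = GcoK i b B cfg O U₁ → 𝔬.Qstar U₁ = QscoKH i b B cfg parB U₁ →
      ∀ (Dd : B.Cfg → Fin (d + 1) → Module.End ℝ (XBK κ i → ℝ)),
      Dd U₁ = (fun μ => coordOpK b (fun _ : Fin (d + 1) => cdBₗ i (cfg U₁) μ)) →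
      ∀ (q : Fin (d + 1) × Fin (d + 1)) {R₀ : ℝ} {H₀ : Prop},
        BlockBd (g := toB6 (geo9K i) R₀ H₀) 𝔬.blkZ 𝔬.blk ((Dd U₁ q.1 ∘ₗ Dd U₁ q.2) ∘ₗ 𝔬.G0 U₁ ∘ₗ 𝔬.Qstar U₁)
          (fun y y' => B₄ * (((geo9K i).len y)⁻¹ * (Real.sqrt (((((ℓ + 1 : ℕ) : ℝ) ^ (d + 1)) ^ lvl i.hN i.D i.hk y')⁻¹) * (geo9K i).len y')) *
            Real.exp (-(δ₄ * (geo9K i).dist y y'))) := by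
  obtain ⟨M₁, δ₃, C, hM₁, hδ₃, hC, H⟩ := blockBd_Gop_kIdx (d := d) (ℓ := ℓ) (hd := hd) (hL := hL) hb₀ hb₁
  obtain ⟨N, c, -, hc0, hcon⟩ := consts_260_261 d ℓ hδ₃
  set Lr : ℝ := (((ℓ + 1 : ℕ) : ℝ)) with hLr
  have hLr1 : 1 ≤ Lr := by rw [hLr]; exact_mod_cast Nat.succ_le_succ (Nat.zero_le ℓ)
  set lg : ℝ := Real.log Lr with hlg
  have hlg0 : 0 ≤ lg := Real.log_nonneg hLr1
  set AQ : ℝ := C * c * Real.exp (3 / 4 * δ₃ * ((ℓ : ℝ) + 4)) * Real.sqrt (Real.exp (1 / 4 * δ₃) * c) * Lr with hAQ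
  have hAQ0 : 0 ≤ AQ := by positivity
  set B₄ : ℝ := AQ + 1 with hB₄
  have hB₄pos : 0 < B₄ := by positivity
  have hAQB : AQ ≤ B₄ := by linarith
  refine ⟨max (max M₁ ((N : ℝ) + 1)) (4 * lg / δ₃), B₄, δ₃ / 2, lt_max_of_lt_left (lt_max_of_lt_left hM₁), hB₄pos, by positivity, ?_⟩
  intro i hM hG _ b hc B cfg O parB hparB hO U₁ hU₁ bI hlev hβ1 𝔬 hblk hblkZ hG0 hQs Dd hDd q R₀ H₀
  have hLcast : (((ℓ + 1 : ℕ) : ℝ)) = (ℓ : ℝ) + 1 := by push_cast; ring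
  have hMdef : (geo9K i).M = (((ℓ + 1 : ℕ) : ℝ)) * (i.Mh : ℝ) := rfl
  have hLdef : (geo9K i).L = Lr := rfl
  have hM₁ : M₁ ≤ (kGeoG i).M := ((le_max_left _ _).trans (le_max_left _ _)).trans hM
  have hN : (N : ℝ) + 1 ≤ ((ℓ : ℝ) + 1) * i.Mh := by
    rw [← hLcast, ← hMdef]; exact ((le_max_right _ _).trans (le_max_left _ _)).trans hM
  have hMw : 4 * lg ≤ (geo9K i).M * δ₃ := (div_le_iff₀ hδ₃).mp ((le_max_right _ _).trans hM)
  have hR1 : 1 ≤ i.R := le_trans (by omega) (toKT i).hR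
  have hRN : N + 1 ≤ i.R * ((ℓ + 1) * i.Mh) := by
    have h2 : N + 1 ≤ (ℓ + 1) * i.Mh := by exact_mod_cast hN
    calc N + 1 ≤ 1 * ((ℓ + 1) * i.Mh) := by rw [one_mul]; exact h2
      _ ≤ i.R * ((ℓ + 1) * i.Mh) := Nat.mul_le_mul_right _ hR1
  obtain ⟨-, h261⟩ := hcon i.k i.Mh i.R i.P' (one_le_Mh i) (toKT i).hP hRN
  have h261D : Ineq261With c (geomT i.D) δ₃ (1 / 4) := h261 i.D
  obtain ⟨-, -, -, -, h4, -⟩ := H i hM₁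
  have hε4 : 0 < δ₃ / 4 := by positivity
  have hMg1 : ((1 : ℕ) : ℝ) * lg / (δ₃ / 4) ≤ (geo9K i).M := by rw [div_le_iff₀ hε4]; push_cast; linarith
  have hT1 := transfer_threshold i hε4 1 hMg1
  have hDQ := blockBd_DdDd_G0_Qstar_one (Y := Y) (W := W) (R₀ := R₀) (H₀ := H₀) i b B cfg O parB hG hc hparB hO hU₁ hlev hβ1 𝔬 hblk hblkZ hG0 hQs
    Dd hDd hC.le hδ₃.le hc0 h4 h261D hε4 (by simpa using hT1) q.1 q.2
  refine B9SectDL2Decay.BlockBd.mono hDQ fun y y' => ?_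
  have hre : Real.exp (-((3 / 4 * δ₃ - δ₃ / 4) * (geo9K i).dist y y')) = Real.exp (-(δ₃ / 2 * (geo9K i).dist y y')) := by
    congr 1; ring
  rw [hre, hLdef]
  have hX : 0 ≤ (((geo9K i).len y)⁻¹ * (Real.sqrt (((((ℓ + 1 : ℕ) : ℝ) ^ (d + 1)) ^ lvl i.hN i.D i.hk y')⁻¹) * (geo9K i).len y')) *
      Real.exp (-(δ₃ / 2 * (geo9K i).dist y y')) := by
    have := (hG.lenpos y').le; have := (hG.lenpos y).le; positivity
  calc C * c * Real.exp (3 / 4 * δ₃ * ((ℓ : ℝ) + 4)) * Real.sqrt (Real.exp (1 / 4 * δ₃) * c) * Lr *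
        (((geo9K i).len y)⁻¹ * (Real.sqrt (((((ℓ + 1 : ℕ) : ℝ) ^ (d + 1)) ^ lvl i.hN i.D i.hk y')⁻¹) * (geo9K i).len y')) *
        Real.exp (-(δ₃ / 2 * (geo9K i).dist y y'))
      = AQ * ((((geo9K i).len y)⁻¹ * (Real.sqrt (((((ℓ + 1 : ℕ) : ℝ) ^ (d + 1)) ^ lvl i.hN i.D i.hk y')⁻¹) * (geo9K i).len y')) *
        Real.exp (-(δ₃ / 2 * (geo9K i).dist y y'))) := by rw [hAQ]; ring
    _ ≤ B₄ * ((((geo9K i).len y)⁻¹ * (Real.sqrt (((((ℓ + 1 : ℕ) : ℝ) ^ (d + 1)) ^ lvl i.hN i.D i.hk y')⁻¹) * (geo9K i).len y')) *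
        Real.exp (-(δ₃ / 2 * (geo9K i).dist y y'))) := mul_le_mul_of_nonneg_right hAQB hX
    _ = _ := by ring

end Record

end Literature.MathematicalPhysics.QuantumFieldTheory.Balaban1983to89.B9Letters313AtOneL2DD

end
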